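import Literature.IUT.HodgeTheaters.TemperedCoveringsNodNon
import HarnessLib

/-!
# [IUTchI] Proposition 2.2 — the `ℍ`-instance and the completion atoms of the printed proof (SUB-DAG residual)

Mochizuki, *Inter-universal Teichmüller theory I*, kurims manuscript (May 2020), §2, Proposition 2.2
"Commensurators of Decomposition Subgroups Associated to Sub-semi-graphs", p. 45 l. 44 – p. 46 l. 16
([IUTchI] Prop 2.2 pp.45–46) [claim: Mochizuki2012, status: disputed] (D-0012 claim key; nothing of the
series is asserted here).  SUB-DAG companion (abc-iut cell, D-0068 (1) statements-first, row
«SUBDAG IUTchI:Prop2.2» of `plan/L5/SUBDAG-IUTchI-Prop21-Prop22.md`, seat abc-iut-w5-d028) of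
abc-iut-L5-t1's `TemperedCoverings.lean` (typed predicate
`TemperedGraphGroupData.CommensuratorsOfDecompositionSubgroups`) and abc-iut-L5-t11's kernels
`TemperedGraphGroupData.prop22_of_prop21` / `prop22_of_prop21'` (TemperedCoveringsProofs /
TemperedCoveringsCompactSubgroups), which prove Prop. 2.2 from Prop. 2.1 for `𝔾` modulo THREE named
hypotheses: `hH` ("`Π^tp_ℍ` is commensurably terminal in `Π̂_ℍ`"), `hcl` ("`Π̂_ℍ` = the closure of `Π^tp_ℍ` in
`Π̂_𝔾`") and `hHatH` ("`C_{Π̂_𝔾}(Π̂_ℍ) = Π̂_ℍ`").  The printed proof obtains the first two from [IUTchI]-internal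
steps, which this file types AND proves, so that only the cited input remains:

* P22/L02 (p. 46 l. 1–3: "In particular, by applying this fact to `ℍ` [cf. the discussion preceding
  Proposition 2.1], we conclude that `Π^tp_ℍ` is commensurably terminal in `Π̂_ℍ`"): the `ℍ`-datum
  `TemperedGraphGroupData.restrictH` ("we shall apply the notation introduced above for “`𝔾`” to `ℍ`",
  p. 44 l. 33) and `tpH_in_hatH_of_prop21H` — `hH` from PROP. 2.1 FOR THE `ℍ`-DATUM plus one infinite
  compact subgroup of `Π^tp_ℍ` (a verticial subgroup of `ℍ`), through abc-iut-L5-t11's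
  `tp_isCommensurablyTerminal_of_prop21'`;
* P22/L03 atom (p. 46 l. 7–8: "where we think of `Π̂_ℍ`, `Π̂_𝔾`, respectively, as the pro-`Σ̂` completions of
  `Π^tp_ℍ`, `Π^tp_𝔾`"): `topologicalClosure_map_eq_of_denseRange` — `hcl` from DENSITY of `Π^tp_ℍ` in `Π̂_ℍ`
  (a field of the tree's `IsProfiniteCompletion`, [SemiAnbd] Prop 3.6 (iii)) and closedness of `Π̂_ℍ`;
* P22/L05 assembly `prop22_of_prop21_of_prop21H`: Prop. 2.2 AS TYPED from Prop. 2.1 for `𝔾`, Prop. 2.1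
  for `ℍ`, one infinite compact subgroup in each of `Π^tp_𝔾`, `Π^tp_ℍ`, density, closedness, and the ONE
  cited input P22/L04 `hHatH : C_{Π̂_𝔾}(Π̂_ℍ) = Π̂_ℍ` ("the evident pro-`Σ̂` analogue of [SemiAnbd],
  Corollary 2.7, (i)", p. 46 l. 9–11 — consumed BY NAME as a hypothesis, never asserted; its typed
  `Σ̂ = 𝔓𝔯𝔦𝔪𝔢𝔰` form is abc-iut-L3-t1's `Literature.AnabelianGeometry.SemiGraphs.corollary_2_7_i`).

* `prop22_byName` — **[IUTchI] Prop. 2.2 AS TYPED with EVERY printed input BY NAME** (the capstone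
  abc-iut-L5-t11 gave for the "in particular" clause only, `prop22_inParticular_byName`): charts of
  `π₁^temp` for `𝔾` AND for `ℍ` ([SemiAnbd] Prop 3.6 (i)(ii)), profinite completions (Prop 3.6 (iii)), the
  Galois-domination hypothesis, `CompactInVerticial` / `Thm37Hypotheses` / `VerticialInjective` (Thm 3.7
  (i)(iii)), `PSCDatum.VerticialIntersectionNear` ([NodNon] Lem 1.9 (ii) = "[AbsTopII] Prop 1.3 (iv) /
  [NodNon] Prop 3.9 (i)") for both pro-`Σ̂` groups, closedness of `Π̂_ℍ`, and `hHatH` (pro-`Σ̂` Cor. 2.7 (i)).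

One definition (`restrictH`, pure data: the same groups restricted to `ℍ`), no new `Prop` fact, no
instance, no notation.  typed ≠ proved for the remaining inputs; nothing here bears on [IUTchIII]
Cor. 3.12 or takes a side.
-/

namespace Literature.IUT.HodgeTheaters

open Pointwise Topology
open Literature.AnabelianGeometry.SemiGraphs (IsProfiniteCompletion PSCDatum ProfiniteSemiGraph)
open Literature.AnabelianGeometry.SemiGraphs.ProfiniteSemiGraph (TemperedPiChart verticialSubgroups
  CompactInVerticial VerticialInjective)
open Literature.AnabelianGeometry.AbsoluteAnabelian (IsCommensurablyTerminal)

universe u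

namespace TemperedGraphGroupData

variable (D : TemperedGraphGroupData.{u})

/-! ### P22/L02 — the `ℍ`-datum ("we shall apply the notation introduced above for `𝔾` to `ℍ`", p. 44) -/

/-- Every element of `Π^tp_ℍ` maps into `Π̂_ℍ` under `Π^tp_𝔾 ↪ Π̂_𝔾` (the commutative diagram of inclusions,
p. 44 — t1's field `tpH_le`). [cite: Mochizuki2012, §2 p.44] -/
theorem ι_mem_hatH_of_mem_tpH {x : D.Tp} (hx : x ∈ D.TpH) : D.ι x ∈ D.HatH :=
  D.tpH_le ⟨x, hx, rfl⟩

/-- **The `ℍ`-datum** ([IUTchI] §2 p. 44 l. 33: "we shall apply the notation introduced above for “`𝔾`” to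
`ℍ`. We thus obtain a natural commutative diagram … of inclusions"): the same pair of topological groups
restricted to the sub-semi-graph `ℍ` — `Π^tp_ℍ ↪ Π̂_ℍ` — as a `TemperedGraphGroupData` (with `ℍ` as its own
sub-semi-graph), so that Proposition 2.1 / 2.2 "for `ℍ`" are literally the typed predicates of this datum.
Needs `Π̂_ℍ` closed in `Π̂_𝔾` (it is a decomposition group, p. 45 l. 4) for compactness.  Pure data.
[cite: Mochizuki2012, §2 p.44] -/
abbrev restrictH (hcH : IsClosed (D.HatH : Set D.Hat)) : TemperedGraphGroupData.{u} where
  Sigma := D.Sigma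
  SigmaHat := D.SigmaHat
  sigma_subset := D.sigma_subset
  sigma_nonempty := D.sigma_nonempty
  sigmaHat_prime := D.sigmaHat_prime
  Tp := D.TpH
  Hat := D.HatH
  hatCompact := isCompact_iff_compactSpace.mp hcH.isCompact
  ι := (D.ι.comp D.TpH.subtype).codRestrict D.HatH fun x => D.ι_mem_hatH_of_mem_tpH x.2
  ι_continuous := (D.ι_continuous.comp continuous_subtype_val).subtype_mk _
  ι_injective := fun _ _ hxy =>
    Subtype.ext (D.ι_injective (congrArg Subtype.val hxy))
  TpH := ⊤
  HatH := ⊤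
  tpH_le := le_top

/-- The injection of the `ℍ`-datum is `Π^tp_ℍ ∋ x ↦ ι(x) ∈ Π̂_ℍ` (the commutative diagram of inclusions, p. 44).
[cite: Mochizuki2012, §2 p.44] -/
theorem restrictH_ι_apply (hcH : IsClosed (D.HatH : Set D.Hat)) (x : D.TpH) :
    (((D.restrictH hcH).ι x : D.HatH) : D.Hat) = D.ι x := rfl

/-- The image of `Π^tp_ℍ` in `Π̂_ℍ` for the `ℍ`-datum is `Π^tp_ℍ ⊆ Π̂_ℍ` read inside `Π̂_𝔾`, i.e. t11's
subgroup `(Π^tp_ℍ.map ι).subgroupOf Π̂_ℍ` (the commutative diagram of inclusions, p. 44).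
[cite: Mochizuki2012, §2 p.44] -/
theorem restrictH_range (hcH : IsClosed (D.HatH : Set D.Hat)) :
    (D.restrictH hcH).ι.range = (D.TpH.map D.ι).subgroupOf D.HatH := by
  ext h
  constructor
  · rintro ⟨x, rfl⟩
    exact Subgroup.mem_subgroupOf.mpr ⟨x.1, x.2, rfl⟩
  · intro hh
    obtain ⟨x, hxH, hx⟩ := Subgroup.mem_subgroupOf.mp hh
    exact ⟨⟨x, hxH⟩, Subtype.ext hx⟩

/-- **P22/L02** ([IUTchI] Prop 2.2, proof p. 46 l. 1–3: "by applying this fact to `ℍ` … we conclude that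
`Π^tp_ℍ` is commensurably terminal in `Π̂_ℍ`") — PROVED from its printed inputs: Proposition 2.1 FOR THE
`ℍ`-DATUM (`h21H`, the typed predicate of `D.restrictH`) and one infinite compact subgroup of `Π^tp_ℍ`
("any verticial subgroup", p. 45 l. −3; `hVH`), via abc-iut-L5-t11's elementary
`tp_isCommensurablyTerminal_of_prop21'`.  This discharges the hypothesis `hH` of t11's `prop22_of_prop21`.
[claim: Mochizuki2012, status: disputed] -/
theorem tpH_in_hatH_of_prop21H [T2Space D.Tp] (hcH : IsClosed (D.HatH : Set D.Hat))
    (h21H : (D.restrictH hcH).ProfiniteConjugatesOfCompactSubgroups)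
    (hVH : ∃ V : Subgroup D.TpH, IsCompact (V : Set D.TpH) ∧ (V : Set D.TpH).Infinite) :
    IsCommensurablyTerminal ((D.TpH.map D.ι).subgroupOf D.HatH) := by
  rw [← restrictH_range D hcH]
  exact (D.restrictH hcH).tp_isCommensurablyTerminal_of_prop21' h21H hVH

/-! ### P22/L03 atom — "`Π̂_ℍ`, `Π̂_𝔾` as the pro-`Σ̂` completions of `Π^tp_ℍ`, `Π^tp_𝔾`" (p. 46 l. 7–8) -/

/-- **P22/L03 atom** ([IUTchI] Prop 2.2, proof p. 46 l. 7–8): if `Π^tp_ℍ` is DENSE in `Π̂_ℍ` (the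
profinite-completion property, [SemiAnbd] Prop 3.6 (iii) — `IsProfiniteCompletion.denseRange` in the
tree) and `Π̂_ℍ` is closed in `Π̂_𝔾`, then the closure of `Π^tp_ℍ` in `Π̂_𝔾` is `Π̂_ℍ` — the hypothesis `hcl`
of t11's `prop22_of_prop21`. PROVED. [claim: Mochizuki2012, status: disputed] -/
theorem topologicalClosure_map_eq_of_denseRange (hcH : IsClosed (D.HatH : Set D.Hat))
    (hd : DenseRange (D.restrictH hcH).ι) :
    (D.TpH.map D.ι).topologicalClosure = D.HatH := by
  apply le_antisymm
  · exact (D.TpH.map D.ι).topologicalClosure_minimal D.tpH_le hcH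
  · intro h hh
    -- `⟨h, hh⟩` lies in the closure of the range of `ι_ℍ` inside `Π̂_ℍ`; push forward along the inclusion
    have hmem : (⟨h, hh⟩ : D.HatH) ∈ closure (Set.range (D.restrictH hcH).ι) := by
      rw [hd.closure_range]; exact Set.mem_univ _
    have himg : ((↑) : D.HatH → D.Hat) '' Set.range (D.restrictH hcH).ι ⊆ (D.TpH.map D.ι : Set D.Hat) := by
      rintro _ ⟨y, ⟨x, rfl⟩, rfl⟩
      exact ⟨x.1, x.2, rfl⟩
    have hcont : Continuous ((↑) : D.HatH → D.Hat) := continuous_subtype_val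
    have : (h : D.Hat) ∈ closure ((D.TpH.map D.ι : Set D.Hat)) :=
      closure_mono himg (mem_closure_image hcont.continuousAt hmem)
    exact this

/-! ### P22/L05 — assembly: Proposition 2.2 from Proposition 2.1 for `𝔾` and for `ℍ` -/

/-- **Proposition 2.2 from Proposition 2.1 for `𝔾` AND for `ℍ`** ([IUTchI] Prop 2.2, proof p. 45 l. 51 –
p. 46 l. 16, all five printed steps): P22/L01 (`Π^tp_𝔾` c.t. in `Π̂_𝔾` ⇐ Prop. 2.1 for `𝔾` + an infinite
compact subgroup, t11) · P22/L02 (the `ℍ`-instance, `tpH_in_hatH_of_prop21H`) · P22/L03 (commensurator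
monotonicity + completions, t11's `tpH_in_hat_of_closure` with `hcl` from density) · P22/L04 = the ONE
cited input `hHatH : C_{Π̂_𝔾}(Π̂_ℍ) = Π̂_ℍ` ("the evident pro-`Σ̂` analogue of [SemiAnbd], Corollary 2.7, (i)",
consumed BY NAME) · P22/L05 assembly (t11's `prop22_of_prop21'`).  So Prop. 2.2 AS TYPED holds modulo:
Prop. 2.1 for `𝔾` and for `ℍ`, one infinite compact subgroup in each tempered group, density of `Π^tp_ℍ` in
`Π̂_ℍ`, closedness of `Π̂_ℍ`, and the pro-`Σ̂` Cor. 2.7 (i).  PROVED; nothing asserted.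
[claim: Mochizuki2012, status: disputed] -/
theorem prop22_of_prop21_of_prop21H [T2Space D.Tp] (hcH : IsClosed (D.HatH : Set D.Hat))
    (h21 : D.ProfiniteConjugatesOfCompactSubgroups)
    (hV : ∃ V : Subgroup D.Tp, IsCompact (V : Set D.Tp) ∧ (V : Set D.Tp).Infinite)
    (h21H : (D.restrictH hcH).ProfiniteConjugatesOfCompactSubgroups)
    (hVH : ∃ V : Subgroup D.TpH, IsCompact (V : Set D.TpH) ∧ (V : Set D.TpH).Infinite)
    (hd : DenseRange (D.restrictH hcH).ι)
    (hHatH : IsCommensurablyTerminal D.HatH) :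
    D.CommensuratorsOfDecompositionSubgroups :=
  D.prop22_of_prop21' h21 hV (D.tpH_in_hatH_of_prop21H hcH h21H hVH) hHatH
    (D.topologicalClosure_map_eq_of_denseRange hcH hd)

/-! ### Proposition 2.2 with every printed input BY NAME (charts for `𝔾` and for `ℍ`) -/

variable {𝒢 𝒢H : ProfiniteSemiGraph.{u}}

/-- **[IUTchI] Proposition 2.2 AS TYPED with EVERY printed input BY NAME** — the four clauses
`C_{Π̂_𝔾}(Π̂_ℍ) = Π̂_ℍ`, `C_{Π̂_𝔾}(Π^tp_ℍ) = Π^tp_ℍ`, `C_{Π^tp_𝔾}(Π^tp_ℍ) = Π^tp_ℍ`, `C_{Π̂_𝔾}(Π^tp_𝔾) = Π^tp_𝔾`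
(`CommensuratorsOfDecompositionSubgroups`), from: abc-iut-L5-t11's `prop21_byName` applied to the `𝔾`-datum
`D` (chart `c`, `e`; …) AND to the `ℍ`-datum `D.restrictH hcH` (chart `cH`, `eH`; … — "we shall apply the
notation introduced above for `𝔾` to `ℍ`", p. 44; "by applying this fact to `ℍ`", p. 46), the verticial
subgroups `Λv (σ v₀)` / `ΛvH (σH w₀)` as the infinite compact subgroups (`exists_infinite_compact_of_chart`,
Thm 3.7 (i) `VerticialInjective`), density of `Π^tp_ℍ` in `Π̂_ℍ` from `IsProfiniteCompletion` of the
`ℍ`-datum, and the ONE cited input `hHatH` ("the evident pro-`Σ̂` analogue of [SemiAnbd], Corollary 2.7,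
(i)").  PROVED; every deep input is a named hypothesis, nothing is asserted.
([IUTchI] Prop 2.2 pp.45–46) [claim: Mochizuki2012, status: disputed] -/
theorem prop22_byName [T2Space D.Tp] (hcH : IsClosed (D.HatH : Set D.Hat))
    -- the `𝔾`-datum, as in `prop21_byName`
    (c : TemperedPiChart 𝒢) (e : D.Tp ≃ₜ* c.G) (h𝒢 : 𝒢.Thm37Hypotheses)
    (hCV : CompactInVerticial.{u}) (hVI : VerticialInjective.{u})
    (hPC : IsProfiniteCompletion
      ({ toMonoidHom := D.ι, continuous_toFun := D.ι_continuous } : D.Tp →ₜ* D.Hat))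
    (hGal : ∀ S : ProfiniteSemiGraph.BTempCat 𝒢,
      Literature.AlgebraicGeometry.Frobenioids.IsConnectedObj S →
      ∃ (H : ProfiniteSemiGraph.BTempCat 𝒢) (_ : H ⟶ S),
        Literature.AnabelianGeometry.SemiGraphs.IsGaloisObj H ∧
          Group.ResiduallyFinite (CategoryTheory.Aut H))
    (G : PSCDatum D.Hat) (hNN : G.VerticialIntersectionNear) (σ : 𝒢.graph.Vertex ≃ G.graph.V)
    (Λv : G.graph.V → Subgroup D.Tp)
    (hvert : ∀ v : 𝒢.graph.Vertex, (Λv (σ v)).map (e : D.Tp →* c.G) ∈ verticialSubgroups c v)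
    (hΛv : ∀ v, (Λv v).map D.ι = G.vertGp v)
    (src tgt : G.graph.N → G.graph.V) (c₁ c₂ : G.graph.N → D.Tp)
    (hends : ∀ e, G.graph.nodeEnds e = s(src e, tgt e))
    (h₁ : ∀ e, G.nodeGp e ≤ MulAut.conj (D.ι (c₁ e)) • G.vertGp (src e))
    (h₂ : ∀ e, G.nodeGp e ≤ MulAut.conj (D.ι (c₂ e)) • G.vertGp (tgt e))
    (hloop : ∀ e, src e = tgt e → (c₁ e)⁻¹ * c₂ e ∉ Λv (src e))
    -- the `ℍ`-datum `D.restrictH hcH`, likewise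
    (cH : TemperedPiChart 𝒢H) (eH : (D.restrictH hcH).Tp ≃ₜ* cH.G) (h𝒢H : 𝒢H.Thm37Hypotheses)
    (hPCH : IsProfiniteCompletion
      ({ toMonoidHom := (D.restrictH hcH).ι, continuous_toFun := (D.restrictH hcH).ι_continuous } :
        (D.restrictH hcH).Tp →ₜ* (D.restrictH hcH).Hat))
    (hGalH : ∀ S : ProfiniteSemiGraph.BTempCat 𝒢H,
      Literature.AlgebraicGeometry.Frobenioids.IsConnectedObj S →
      ∃ (H : ProfiniteSemiGraph.BTempCat 𝒢H) (_ : H ⟶ S),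
        Literature.AnabelianGeometry.SemiGraphs.IsGaloisObj H ∧
          Group.ResiduallyFinite (CategoryTheory.Aut H))
    (GH : PSCDatum (D.restrictH hcH).Hat) (hNNH : GH.VerticialIntersectionNear)
    (σH : 𝒢H.graph.Vertex ≃ GH.graph.V)
    (ΛvH : GH.graph.V → Subgroup (D.restrictH hcH).Tp)
    (hvertH : ∀ v : 𝒢H.graph.Vertex,
      (ΛvH (σH v)).map (eH : (D.restrictH hcH).Tp →* cH.G) ∈ verticialSubgroups cH v)
    (hΛvH : ∀ v, (ΛvH v).map (D.restrictH hcH).ι = GH.vertGp v)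
    (srcH tgtH : GH.graph.N → GH.graph.V) (c₁H c₂H : GH.graph.N → (D.restrictH hcH).Tp)
    (hendsH : ∀ e, GH.graph.nodeEnds e = s(srcH e, tgtH e))
    (h₁H : ∀ e, GH.nodeGp e ≤ MulAut.conj ((D.restrictH hcH).ι (c₁H e)) • GH.vertGp (srcH e))
    (h₂H : ∀ e, GH.nodeGp e ≤ MulAut.conj ((D.restrictH hcH).ι (c₂H e)) • GH.vertGp (tgtH e))
    (hloopH : ∀ e, srcH e = tgtH e → (c₁H e)⁻¹ * c₂H e ∉ ΛvH (srcH e))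
    -- the one cited input
    (hHatH : IsCommensurablyTerminal D.HatH) :
    D.CommensuratorsOfDecompositionSubgroups := by
  have h21 : D.ProfiniteConjugatesOfCompactSubgroups :=
    D.prop21_byName c e h𝒢 hCV hPC hGal G hNN σ Λv hvert hΛv src tgt c₁ c₂ hends h₁ h₂ hloop
  have h21H : (D.restrictH hcH).ProfiniteConjugatesOfCompactSubgroups :=
    (D.restrictH hcH).prop21_byName cH eH h𝒢H hCV hPCH hGalH GH hNNH σH ΛvH hvertH hΛvH srcH tgtH
      c₁H c₂H hendsH h₁H h₂H hloopH
  obtain ⟨v₀, hv₀c, hv₀inf⟩ :=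
    D.exists_infinite_compact_of_chart c e h𝒢 hVI (fun v => Λv (σ v)) hvert
  obtain ⟨w₀, hw₀c, hw₀inf⟩ :=
    (D.restrictH hcH).exists_infinite_compact_of_chart cH eH h𝒢H hVI (fun v => ΛvH (σH v)) hvertH
  exact D.prop22_of_prop21_of_prop21H hcH h21 ⟨_, hv₀c, hv₀inf⟩ h21H ⟨_, hw₀c, hw₀inf⟩
    hPCH.denseRange hHatH

end TemperedGraphGroupData

end Literature.IUT.HodgeTheaters
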